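import Literature.Probability.MarkovChains.PeskunOrdering
import Literature.Probability.MarkovChains.BirthDeathHittingTimes

/-!
HONEST FRAMING: exact (Metropolis-corrected) sampling algorithms for lattice gauge theory; figures
of merit are autocorrelation/cost numbers at stated couplings and volumes; no continuum-physics
claim.

# SwapLadderIndexPoisson — THE POISSON EQUATION OF THE REPLICA INDEX ON A SWAP LADDER WITH AN ARBITRARY
# ACCEPTANCE PROFILE, SOLVED IN CLOSED FORM: for the idealised label walk on the rungs `0 … K` (bond `j` crossed
# either way with probability `a_j/2` per swap scan) the centred index `k − K/2` has `(I − P) g = k − K/2` with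
# `g(k) = Σ_{j<k} w_j/a_j`, `w_j = (j+1)(K−j)`, and `⟨k − K/2, g⟩_unif = (1/(K+1))·Σ_{j<K} w_j²/(2a_j)`
# (row 22 `su3-ptbc`, GEN-6, ours; part 1 of 2 — the asymptotic variance / integrated autocorrelation time
# `τ_int = (6/(K(K+1)(K+2)))·Σ_j w_j²/a_j − 1/2` is the sequel `SwapLadderIndexTauInt`)

Venture `LatticeQCDFlow` (cell pub-lqcd), topic `Scaling`; FANOUT row 22 (`su3-ptbc`, PTBC comparator arm E4).
NEW WORK of the cell over the tree's Literature finite-chain vocabulary ONLY (`Literature.Probability.MarkovChains`: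
`bdKernel n p q` with `bdKernel_apply_*`, `sum_bdKernel`, `sum_bdKernel_mul` — Levin–Peres–Wilmer §2.5; `piInner`,
`centred`, `limitMatrix`, `IsStationary`, `sum_mul_centred` — the Peskun / Andrieu–Vihola conventions of
`PeskunOrdering`).  Nothing is cited as a fact; no `native_decide`.  THE WALK IS GIVEN BY HYPOTHESES on a
birth–death kernel — `p k = a k/2` (`k < K`), `p K = 0`, `q 0 = 0`, `q k = a (k−1)/2` (`1 ≤ k ≤ K`) — so that BOTH
row 22's `Scaling/SwapLadderRoundTrip.profileWalk K a = bdKernel K (profileUp K a) (profileDown a)` (GEN-5, staged;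
constant profile = GEN-4's `SwapLadderDeliveryTime.ladderWalk`) and lean-2's lumped tag / level walks (their staged
`ptLevelWalk`, `stLevelWalk`) are instances, while no module of either is imported (nothing here waits on the build
lane).  The profile `a : ℕ → ℝ` is ARBITRARY (e.g. the MEASURED per-pair acceptances of a run); `a_j ≠ 0` where
stated.

## What is proved (`π = unifLaw K` uniform on `Fin (K+1)`; `w_j = passageWeight K j = (j+1)(K−j)`)

§0 `sum_range_poly4` (Faulhaber to degree 4, closed form); **`sum_mul_partialSum_eq`** (summation by parts:
   `Σ_{k<n} u_k Σ_{j<k} x_j = Σ_{j<n} x_j Σ_{k∈(j,n)} u_k`).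
§1 `unifLaw`, `levelObs` (`k ↦ k`), `passageWeight`, **`levelPoissonRaw K a k = Σ_{j<k} w_j/a_j`**, `levelPoisson`
   (centred); `sum_unifLaw`, mean `K/2`, `centred_levelObs`, **`piInner_centred_levelObs`** (`Var_unif(index) =
   K(K+2)/12`), `sum_Ico_centred_levelObs` (the centred mass above bond `j` is `w_j/2`),
   `levelPoissonRaw_sub_of_val_eq` (increments `w_j/a_j`), **`piInner_centred_levelObs_levelPoissonRaw`** /
   `…_levelPoisson` (`⟨k − K/2, g⟩_π = (1/(K+1))Σ_j w_j²/(2a_j)`, by parts), `sum_unifLaw_mul_levelPoisson`.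
§2 `sum_bdKernel_last_mul`, **`bdKernel_profile_symm`** (the walk is a symmetric matrix: bond `j` is crossed at
   rate `a_j/2` from either side), **`unifLaw_isStationary`**, `fundamentalInv_mulVec_apply`, `sum_bdKernel_mul_const`.
§3 **`levelPoissonRaw_poisson`** / `levelPoisson_poisson` — `g − P g = k − K/2` at every rung (bottom `q₀ = 0`,
   interior `−(a_k/2)(w_k/a_k) + (a_{k−1}/2)(w_{k−1}/a_{k−1}) = k − K/2`, top `p_K = 0`).

NOT CLAIMED: anything about PTBC itself (the walk is the idealisation of CARD §1.6 / GEN-4–5; the card MEASURES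
autocorrelations); the driver's non-reversible even–odd scheme (its lifted walk, staged GEN-5 `deoWalk`, has index
`τ_int = (6/(K(K+1)(K+2)))·Σ_j w_j² r_j/s_j` by the same method — exact numerics for random profiles; the flat case
is typed in the staged `SwapLadderIndexTauIntDEO`).
-/

noncomputable section

open Finset Matrix
open Literature.Probability.MarkovChains

namespace Summit.Ventures.LatticeQCDFlow.Scaling

/-! ## §0 Two summation identities -/

section Sums

/-- Sum of a quartic polynomial over `range n`, in closed form (Faulhaber up to degree 4). [folklore] -/
theorem sum_range_poly4 (n : ℕ) (c0 c1 c2 c3 c4 : ℝ) :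
    ∑ k ∈ range n, (c0 + c1 * (k : ℝ) + c2 * (k : ℝ) ^ 2 + c3 * (k : ℝ) ^ 3 + c4 * (k : ℝ) ^ 4)
      = c0 * n + c1 * ((n : ℝ) * (n - 1) / 2) + c2 * ((n : ℝ) * (n - 1) * (2 * n - 1) / 6)
        + c3 * ((n : ℝ) * (n - 1) / 2) ^ 2 + c4 * ((n : ℝ) * (n - 1) * (2 * n - 1) * (3 * n ^ 2 - 3 * n - 1) / 30) := by
  induction n with
  | zero => simp
  | succ n ih => rw [sum_range_succ, ih]; push_cast; ring

/-- **Summation by parts for a partial-sum sequence**: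
`Σ_{k<n} u_k·(Σ_{j<k} x_j) = Σ_{j<n} x_j·(Σ_{k ∈ (j, n)} u_k)`. [folklore] -/
theorem sum_mul_partialSum_eq (u x : ℕ → ℝ) (n : ℕ) :
    ∑ k ∈ range n, u k * (∑ j ∈ range k, x j) = ∑ j ∈ range n, x j * (∑ k ∈ Ico (j + 1) n, u k) := by
  induction n with
  | zero => simp
  | succ n ih =>
    rw [sum_range_succ, ih, sum_range_succ, Finset.Ico_self, sum_empty, mul_zero, add_zero]
    have h : ∀ j ∈ range n, x j * ∑ k ∈ Ico (j + 1) (n + 1), u k = x j * ∑ k ∈ Ico (j + 1) n, u k + x j * u n := by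
      intro j hj
      rw [Finset.sum_Ico_succ_top (by have := mem_range.mp hj; omega), mul_add]
    rw [sum_congr rfl h, sum_add_distrib, ← sum_mul, mul_comm (u n)]

end Sums

/-! ## §1 Objects: uniform law, index observable, passage weights, the Poisson solution for ANY acceptance profile -/

section Objects

/-- The uniform law on the `K+1` rungs (stationary for the ladder walk with any acceptance profile). [ours] -/
def unifLaw (K : ℕ) : Fin (K + 1) → ℝ := fun _ => 1 / ((K : ℝ) + 1)

/-- The replica-index observable `k ↦ k`. [ours] -/
def levelObs (K : ℕ) : Fin (K + 1) → ℝ := fun k => (k.val : ℝ)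

/-- **Passage weight of bond `j`**: `w_j = (j+1)(K−j)` — the number of (rung below, rung above) pairs the bond
separates; `w_j/2 = −Σ_{i≤j}(i − K/2)` is the centred-index mass below the bond. [ours] -/
def passageWeight (K : ℕ) (j : ℕ) : ℝ := ((j : ℝ) + 1) * ((K : ℝ) - j)

/-- **The (uncentred) Poisson solution for the index under the profile `a`**: `g(k) = Σ_{j<k} w_j/a_j` — its
increments `g(k+1) − g(k) = (k+1)(K−k)/a_k` solve the first-step equations of `(I − P)g = k − K/2`. [ours] -/
def levelPoissonRaw (K : ℕ) (a : ℕ → ℝ) : Fin (K + 1) → ℝ :=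
  fun k => ∑ j ∈ range k.val, passageWeight K j / a j

/-- The centred Poisson solution `g − π(g)` (this is `Z(k − K/2)` of the sequel). [ours] -/
def levelPoisson (K : ℕ) (a : ℕ → ℝ) : Fin (K + 1) → ℝ :=
  fun k => levelPoissonRaw K a k - ∑ x, unifLaw K x * levelPoissonRaw K a x

variable (K : ℕ)

/-- `Σ π = 1`. [ours] -/
theorem sum_unifLaw : ∑ x, unifLaw K x = 1 := by
  simp only [unifLaw, sum_const, card_univ, Fintype.card_fin, nsmul_eq_mul]
  have : ((K : ℝ) + 1) ≠ 0 := by positivity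
  push_cast
  field_simp

/-- `π > 0`. [ours] -/
theorem unifLaw_pos (x : Fin (K + 1)) : 0 < unifLaw K x := by
  unfold unifLaw; positivity

/-- The mean index is `K/2`. [ours] -/
theorem sum_unifLaw_mul_levelObs : ∑ x, unifLaw K x * levelObs K x = (K : ℝ) / 2 := by
  simp only [unifLaw, levelObs]
  rw [← mul_sum, Fin.sum_univ_eq_sum_range (fun k : ℕ => (k : ℝ)) (K + 1)]
  have e : ∑ k ∈ range (K + 1), (k : ℝ)
      = ∑ k ∈ range (K + 1), (0 + 1 * (k : ℝ) + 0 * (k : ℝ) ^ 2 + 0 * (k : ℝ) ^ 3 + 0 * (k : ℝ) ^ 4) :=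
    sum_congr rfl fun k _ => by ring
  rw [e, sum_range_poly4]
  have : ((K : ℝ) + 1) ≠ 0 := by positivity
  push_cast
  field_simp
  ring

/-- The centred index is `k − K/2`. [ours] -/
theorem centred_levelObs : centred (unifLaw K) (levelObs K) = fun k => (k.val : ℝ) - (K : ℝ) / 2 := by
  funext k
  rw [centred, sum_unifLaw_mul_levelObs]
  rfl

/-- **The variance of the index under the uniform law is `K(K+2)/12`.** [ours] -/
theorem piInner_centred_levelObs :
    piInner (unifLaw K) (centred (unifLaw K) (levelObs K)) (centred (unifLaw K) (levelObs K))
      = (K : ℝ) * (K + 2) / 12 := by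
  rw [centred_levelObs]
  simp only [piInner, unifLaw]
  rw [← mul_sum, Fin.sum_univ_eq_sum_range (fun k : ℕ => ((k : ℝ) - (K : ℝ) / 2) * ((k : ℝ) - (K : ℝ) / 2)) (K + 1)]
  have e : ∑ k ∈ range (K + 1), ((k : ℝ) - (K : ℝ) / 2) * ((k : ℝ) - (K : ℝ) / 2)
      = ∑ k ∈ range (K + 1), ((K : ℝ) ^ 2 / 4 + (-(K : ℝ)) * (k : ℝ) + 1 * (k : ℝ) ^ 2 + 0 * (k : ℝ) ^ 3
        + 0 * (k : ℝ) ^ 4) := sum_congr rfl fun k _ => by ring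
  rw [e, sum_range_poly4]
  have : ((K : ℝ) + 1) ≠ 0 := by positivity
  push_cast
  field_simp
  ring

/-- The centred-index mass ABOVE bond `j`: `Σ_{k ∈ (j, K]} (k − K/2) = w_j/2` (`j < K`). [ours] -/
theorem sum_Ico_centred_levelObs {j : ℕ} (hj : j < K) :
    ∑ k ∈ Ico (j + 1) (K + 1), ((k : ℝ) - (K : ℝ) / 2) = passageWeight K j / 2 := by
  rw [Finset.sum_Ico_eq_sub _ (by omega : j + 1 ≤ K + 1)]
  have e : ∀ n : ℕ, ∑ k ∈ range n, ((k : ℝ) - (K : ℝ) / 2)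
      = ∑ k ∈ range n, (-(K : ℝ) / 2 + 1 * (k : ℝ) + 0 * (k : ℝ) ^ 2 + 0 * (k : ℝ) ^ 3 + 0 * (k : ℝ) ^ 4) :=
    fun n => sum_congr rfl fun k _ => by ring
  rw [e, e, sum_range_poly4, sum_range_poly4, passageWeight]
  push_cast
  ring

/-- `g` increments: `g(k) − g(j) = w_j/a_j` whenever `k = j + 1` as rungs. [ours] -/
theorem levelPoissonRaw_sub_of_val_eq (a : ℕ → ℝ) (k j : Fin (K + 1)) (h : k.val = j.val + 1) :
    levelPoissonRaw K a k - levelPoissonRaw K a j = passageWeight K j.val / a j.val := by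
  simp only [levelPoissonRaw]
  rw [h, sum_range_succ]
  ring

/-- **`⟨k − K/2, g⟩_π = (1/(K+1))·Σ_{j<K} w_j²/(2a_j)`** for the uncentred solution (summation by parts). [ours] -/
theorem piInner_centred_levelObs_levelPoissonRaw (a : ℕ → ℝ) :
    piInner (unifLaw K) (centred (unifLaw K) (levelObs K)) (levelPoissonRaw K a)
      = 1 / ((K : ℝ) + 1) * ∑ j ∈ range K, passageWeight K j ^ 2 / (2 * a j) := by
  rw [centred_levelObs]
  simp only [piInner, unifLaw, levelPoissonRaw]
  rw [← mul_sum, Fin.sum_univ_eq_sum_range (fun k : ℕ => ((k : ℝ) - (K : ℝ) / 2) *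
    ∑ j ∈ range k, passageWeight K j / a j) (K + 1), sum_mul_partialSum_eq]
  congr 1
  rw [sum_range_succ, Finset.Ico_self, sum_empty, mul_zero, add_zero]
  refine sum_congr rfl fun j hj => ?_
  rw [sum_Ico_centred_levelObs K (mem_range.mp hj)]
  ring

/-- The centred solution has the same pairing with the centred index. [ours] -/
theorem piInner_centred_levelObs_levelPoisson (a : ℕ → ℝ) :
    piInner (unifLaw K) (centred (unifLaw K) (levelObs K)) (levelPoisson K a)
      = 1 / ((K : ℝ) + 1) * ∑ j ∈ range K, passageWeight K j ^ 2 / (2 * a j) := by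
  rw [← piInner_centred_levelObs_levelPoissonRaw]
  simp only [piInner, levelPoisson, mul_sub, sum_sub_distrib]
  have h0 : ∑ x, unifLaw K x * (centred (unifLaw K) (levelObs K) x * ∑ y, unifLaw K y * levelPoissonRaw K a y) = 0 := by
    rw [show ∑ x, unifLaw K x * (centred (unifLaw K) (levelObs K) x * ∑ y, unifLaw K y * levelPoissonRaw K a y)
        = (∑ x, unifLaw K x * centred (unifLaw K) (levelObs K) x) * ∑ y, unifLaw K y * levelPoissonRaw K a y by
          rw [sum_mul]; exact sum_congr rfl fun x _ => by ring,
      sum_mul_centred (sum_unifLaw K), zero_mul]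
  rw [h0, sub_zero]

/-- `levelPoisson` is centred: `Σ π g = 0`. [ours] -/
theorem sum_unifLaw_mul_levelPoisson (a : ℕ → ℝ) : ∑ x, unifLaw K x * levelPoisson K a x = 0 := by
  simp only [levelPoisson, mul_sub, sum_sub_distrib]
  rw [← sum_mul, sum_unifLaw, one_mul, sub_self]

end Objects

/-! ## §2 The ladder walk with acceptance profile `a` as a birth–death kernel: symmetric, uniform law stationary -/

section Walk

variable {K : ℕ} {a : ℕ → ℝ} {p q : ℕ → ℝ}

/-- Top row against a function: `Σ_j P(K, j) f(j) = q_K f(K−1) + (1 − q_K) f(K)` when `p_K = 0`, `q_0 = 0`.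
[ours] -/
theorem sum_bdKernel_last_mul (hq0 : q 0 = 0) (hpK : p K = 0) (f : Fin (K + 1) → ℝ) :
    ∑ j, bdKernel K p q (Fin.last K) j * f j =
      q K * f ⟨K - 1, by omega⟩ + (1 - q K) * f (Fin.last K) := by
  simp_rw [bdKernel_apply_eq_add, add_mul, sum_add_distrib, ite_mul, zero_mul, Fin.val_last]
  have h1 : ∑ j : Fin (K + 1), (if j.val = K + 1 then p K * f j else 0) = 0 :=
    sum_eq_zero fun j _ => if_neg (by have := j.isLt; omega)
  have h2 : ∑ j : Fin (K + 1), (if K = j.val + 1 then q K * f j else 0) = q K * f ⟨K - 1, by omega⟩ := by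
    by_cases hK : K = 0
    · have hq : q K = 0 := by rw [hK]; exact hq0
      rw [hq, zero_mul]
      exact sum_eq_zero fun j _ => by rw [if_neg (by omega)]
    · rw [Finset.sum_eq_single (⟨K - 1, by omega⟩ : Fin (K + 1)) (fun j _ hj => if_neg fun h => hj
        (Fin.ext (by simp only; omega))) (fun h => absurd (mem_univ _) h), if_pos (by simp only; omega)]
  have h3 : ∑ j : Fin (K + 1), (if Fin.last K = j then (1 - p K - q K) * f j else 0) =
      (1 - q K) * f (Fin.last K) := by
    rw [sum_ite_eq univ (Fin.last K), if_pos (mem_univ _), hpK, sub_zero]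
  rw [h1, h2, h3, zero_add]

/-- **The ladder walk is a symmetric matrix**: `P(x, y) = P(y, x)` (the up-rate of bond `j` from below and the
down-rate from above are both `a_j/2`). [ours] -/
theorem bdKernel_profile_symm (hp : ∀ k, k < K → p k = a k / 2)
    (hq : ∀ k, 1 ≤ k → k ≤ K → q k = a (k - 1) / 2) (x y : Fin (K + 1)) :
    bdKernel K p q x y = bdKernel K p q y x := by
  have hx := x.isLt
  have hy := y.isLt
  by_cases h1 : y.val = x.val + 1
  · rw [bdKernel_apply_succ h1, bdKernel_apply_pred h1, hp x.val (by omega), hq y.val (by omega) (by omega), h1,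
      Nat.add_sub_cancel]
  by_cases h2 : x.val = y.val + 1
  · rw [bdKernel_apply_pred h2, bdKernel_apply_succ h2, hq x.val (by omega) (by omega), hp y.val (by omega), h2,
      Nat.add_sub_cancel]
  by_cases h3 : x = y
  · rw [h3]
  · rw [bdKernel_apply_of_ne h1 h2 h3, bdKernel_apply_of_ne (fun h => h2 h) (fun h => h1 h) (Ne.symm h3)]

/-- **The uniform law is stationary** for the ladder walk with any acceptance profile. [ours] -/
theorem unifLaw_isStationary (hp : ∀ k, k < K → p k = a k / 2) (hpK : p K = 0) (hq0 : q 0 = 0)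
    (hq : ∀ k, 1 ≤ k → k ≤ K → q k = a (k - 1) / 2) : IsStationary (unifLaw K) (bdKernel K p q) := by
  intro y
  simp only [unifLaw]
  have hcol : ∑ x, bdKernel K p q x y = 1 := by
    rw [show ∑ x, bdKernel K p q x y = ∑ x, bdKernel K p q y x from
      sum_congr rfl fun x _ => bdKernel_profile_symm hp hq x y]
    exact sum_bdKernel hq0 hpK y
  rw [← mul_sum, hcol, mul_one]

/-- Entries of `(I − (P − A)) v`: `v x − Σ_y P x y v y + Σ_y π y v y` (any finite state space). [folklore] -/
theorem fundamentalInv_mulVec_apply {X : Type*} [Fintype X] [DecidableEq X] (π : X → ℝ) (P : Matrix X X ℝ)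
    (v : X → ℝ) (x : X) :
    ((1 - (P - limitMatrix π)) *ᵥ v) x = v x - ∑ y, P x y * v y + ∑ y, π y * v y := by
  rw [sub_mulVec, sub_mulVec, one_mulVec, Pi.sub_apply, Pi.sub_apply]
  simp only [mulVec, dotProduct, limitMatrix, Matrix.of_apply]
  ring

/-- Constants are harmonic: `Σ_j P x j · c = c`. [ours] -/
theorem sum_bdKernel_mul_const (hq0 : q 0 = 0) (hpK : p K = 0) (x : Fin (K + 1)) (c : ℝ) :
    ∑ j, bdKernel K p q x j * c = c := by
  rw [← sum_mul, sum_bdKernel hq0 hpK x, one_mul]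

end Walk

/-! ## §3 The Poisson equation `(I − P) g = k − K/2` for every acceptance profile, row by row -/

section Poisson

variable {K : ℕ} {a : ℕ → ℝ} {p q : ℕ → ℝ}

/-- **`g = levelPoissonRaw K a` solves `(I − P) g = k − K/2`** (`a_k ≠ 0` for `k < K`). [ours] -/
theorem levelPoissonRaw_poisson (ha : ∀ k, k < K → a k ≠ 0) (hp : ∀ k, k < K → p k = a k / 2) (hpK : p K = 0)
    (hq0 : q 0 = 0) (hq : ∀ k, 1 ≤ k → k ≤ K → q k = a (k - 1) / 2) (x : Fin (K + 1)) :
    levelPoissonRaw K a x - ∑ y, bdKernel K p q x y * levelPoissonRaw K a y = (x.val : ℝ) - (K : ℝ) / 2 := by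
  rcases Fin.eq_castSucc_or_eq_last x with ⟨i, rfl⟩ | rfl
  · -- a row below the top: `−(a_i/2)(g(i+1) − g(i)) + (a_{i−1}/2)(g(i) − g(i−1)) = i − K/2`
    have hai : a i.val ≠ 0 := ha i.val i.isLt
    have e1 : levelPoissonRaw K a i.succ = levelPoissonRaw K a i.castSucc + passageWeight K i.val / a i.val := by
      have := levelPoissonRaw_sub_of_val_eq K a i.succ i.castSucc (by simp)
      rw [Fin.val_castSucc] at this
      linarith
    rw [sum_bdKernel_mul hq0 i (levelPoissonRaw K a), hp i.val i.isLt, e1]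
    by_cases hi : i.val = 0
    · have hqi : q i.val = 0 := by rw [hi]; exact hq0
      rw [hqi, passageWeight]
      simp only [zero_mul, add_zero, sub_zero, Fin.val_castSucc]
      have hi' : ((i.val : ℕ) : ℝ) = 0 := by exact_mod_cast hi
      rw [hi']
      field_simp
      ring
    · have hqi : q i.val = a (i.val - 1) / 2 := hq i.val (by omega) (by have := i.isLt; omega)
      have hai' : a (i.val - 1) ≠ 0 := ha (i.val - 1) (by have := i.isLt; omega)
      have e2 : levelPoissonRaw K a ⟨i.val - 1, by have := i.isLt; omega⟩
          = levelPoissonRaw K a i.castSucc - passageWeight K (i.val - 1) / a (i.val - 1) := by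
        have := levelPoissonRaw_sub_of_val_eq K a i.castSucc ⟨i.val - 1, by have := i.isLt; omega⟩
          (by simp only [Fin.val_castSucc]; omega)
        linarith
      rw [hqi, e2, passageWeight, passageWeight, Fin.val_castSucc]
      have hcast : (((i.val - 1 : ℕ) : ℝ)) = (i.val : ℝ) - 1 := by rw [Nat.cast_sub (by omega)]; simp
      rw [hcast]
      field_simp
      ring
  · -- the top row: `(a_{K−1}/2)(g(K) − g(K−1)) = K/2`
    rw [sum_bdKernel_last_mul hq0 hpK (levelPoissonRaw K a)]
    by_cases hK : K = 0
    · subst hK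
      have hqK : q 0 = 0 := hq0
      simp [levelPoissonRaw, hqK]
    · have hqK : q K = a (K - 1) / 2 := hq K (by omega) le_rfl
      have haK : a (K - 1) ≠ 0 := ha (K - 1) (by omega)
      have e2 : levelPoissonRaw K a ⟨K - 1, by omega⟩
          = levelPoissonRaw K a (Fin.last K) - passageWeight K (K - 1) / a (K - 1) := by
        have := levelPoissonRaw_sub_of_val_eq K a (Fin.last K) ⟨K - 1, by omega⟩
          (by simp only [Fin.val_last]; omega)
        linarith
      rw [hqK, e2, Fin.val_last, passageWeight]
      have hcast : (((K - 1 : ℕ) : ℝ)) = (K : ℝ) - 1 := by rw [Nat.cast_sub (by omega)]; simp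
      rw [hcast]
      field_simp
      ring

/-- The centred solution solves the same equation (constants are harmonic). [ours] -/
theorem levelPoisson_poisson (ha : ∀ k, k < K → a k ≠ 0) (hp : ∀ k, k < K → p k = a k / 2) (hpK : p K = 0)
    (hq0 : q 0 = 0) (hq : ∀ k, 1 ≤ k → k ≤ K → q k = a (k - 1) / 2) (x : Fin (K + 1)) :
    levelPoisson K a x - ∑ y, bdKernel K p q x y * levelPoisson K a y = (x.val : ℝ) - (K : ℝ) / 2 := by
  rw [← levelPoissonRaw_poisson ha hp hpK hq0 hq x]
  simp only [levelPoisson, mul_sub, sum_sub_distrib]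
  rw [sum_bdKernel_mul_const hq0 hpK]
  ring

end Poisson

end Summit.Ventures.LatticeQCDFlow.Scaling
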